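import Summits.AtomisticToContinuum.Crystallization.Theorems.FrustratedLawDichotomyStrainedPatchHomEntryLeafHTA
import Summits.AtomisticToContinuum.Crystallization.Theorems.FrustratedLawDichotomyStrainedPatchHomSlopeLJAffine2F

/-!
# `entryLeafOKHT4A2F`: the affine-reference slab leaf with the SECOND-ORDER CENTRED slope form (kernel-fast array) on the near chunk (K1-v2)
# (27623 `(H) HomFloor (1/625)`, hcp half; hand-1 g34 FINDING §4; critic row 1284)

decomp-a2c hand-1 g34 (crux `AperiodicFrustratedLawGap`, stmt-AtomisticToContinuum-27623).  Verbatim `…HomEntryLeafHTA` (affine reference `ξ₀(U) = ξ_c + J(U − U_c)`,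
sheet-tracked inner box `hullInner`) with the near-chunk slope bound taken from the second-order centred check `…HomSlopeLJAffine2Fast.slopeCheckLJA2F` (kernel-fast array) (label
guards `ljLabelOK` of the curvature kit on the hull box): `htScA2F/htSnA2F/htNaiOKA2F/htGsA2F`, ★ `refForce_chunkA2F_le`, ★ `refForce_htBU_leA2F`, ★ `htCertSideA2F`,
★ `entryLeafOKHT4A2F inner p J t c w`, ★★★ `entryLeafOKHT4A2F_sound` (proof = `entryLeafOKHT4A_sound` with the chunk lemma swapped).  KERNEL (hand-1 g34 probes
`R1–R4`, near chunk de-scaled): `cX95` 2⁻¹² `1.4e-4` (first-order affine `1.1e-3`, constant `4.4e-3`), cube 2⁻¹¹ `3.1e-4` (`4.3e-3`/`9.5e-3`), W10 `7.6e-4`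
(`1.2e-2`/`1.8e-2`), `cB065` cube 2⁻¹⁰ `1.07e-3` (`1.6e-2`/`2.0e-2`), cube 2⁻⁹ `6.8e-3` (`7.1e-2`/`5.5e-2`) — the slab constant reaches its `σ₁ = 0.0108` floor
up to `2⁻¹⁰`.

Kernel definitions + soundness; 0 sorry; standard axioms; no instances / notation / `#eval`.  `--supports stmt-AtomisticToContinuum-27623`.
-/

noncomputable section

namespace Summit.AtomisticToContinuum.Crystallization.Theorems.FrustratedLawDichotomyStrainedPatchHomEntryLeafHT

open scoped BigOperators RealInnerProductSpace
open Literature.Analysis.ValidatedNumerics.Numerics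
open Summit.AtomisticToContinuum.Crystallization.Theorems.ChargedEnergyGapNegative (E3)
open Summit.AtomisticToContinuum.Crystallization.Theorems.FrustratedLawDichotomySchurCut (effPot w₄₅ ω₄)
open Summit.AtomisticToContinuum.Crystallization.Theorems.FrustratedLawDichotomyAveragingRuleTightFree (TightNearCap BadNearCap)
open Summit.AtomisticToContinuum.Crystallization.Theorems.FrustratedLawDichotomyExemptAbsorption (ExemptNear)
open Summit.AtomisticToContinuum.Crystallization.Theorems.FrustratedLawDichotomyStrainedPatchHomSplit (ExRec latPt hexFrame hcpShift HomFloor)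
open Summit.AtomisticToContinuum.Crystallization.Theorems.FrustratedLawDichotomyStrainedPatchTaylorChord (segGd)
open Summit.AtomisticToContinuum.Crystallization.Theorems.FrustratedLawDichotomyStrainedPatchHomCurvCentreKit (cenShuf cenShuf_apply)
open Summit.AtomisticToContinuum.Crystallization.Theorems.FrustratedLawDichotomyStrainedPatchHomCurvLeaf
  (nodup_filter_append toFinset_filter_append)
open Summit.AtomisticToContinuum.Crystallization.Theorems.FrustratedLawDichotomyStrainedPatchHomCurvLJ (isCenLJ curvCheckLJM naiveLJ ljLabelOK)
open Summit.AtomisticToContinuum.Crystallization.Theorems.FrustratedLawDichotomyStrainedPatchHomForceJacN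
  (fjQ forceJacCheckN boxLabels11 boxLabels11_toFinset boxLabels11_nodup)
open Summit.AtomisticToContinuum.Crystallization.Theorems.FrustratedLawDichotomyStrainedPatchHomSlopeLJ
  (slopeLJLabelOK slopeCheckLJ slopeGsLJ slopeCheckLJ_slopeGsLJ forceLJ_ref_bound_of_check)
open Summit.AtomisticToContinuum.Crystallization.Theorems.FrustratedLawDichotomyStrainedPatchHomSlopeLJAffine
open Summit.AtomisticToContinuum.Crystallization.Theorems.FrustratedLawDichotomyStrainedPatchHomSlopeLJAffine2Kit
open Summit.AtomisticToContinuum.Crystallization.Theorems.FrustratedLawDichotomyStrainedPatchHomSlopeLJAffine2F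
open Summit.AtomisticToContinuum.Crystallization.Theorems.FrustratedLawDichotomyStrainedPatchHomForceHcp (xiBallOK norm_le_quarter_of_xiBallOK)
open Summit.AtomisticToContinuum.Crystallization.Theorems.FrustratedLawDichotomyStrainedPatchHomSlabConfine (abs_apply_le_of_qcert)
open Summit.AtomisticToContinuum.Crystallization.Theorems.FrustratedLawDichotomyStrainedPatchHomSlabLeaf
  (jac_floorM_of_three_checks abs_coord_le_of_confined hver_of_slabParts)
open Summit.AtomisticToContinuum.Crystallization.Theorems.FrustratedLawDichotomyStrainedPatchHomCertTree (CertTree treeOK treeOK_sound)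

/-! ## §1. The reference force bound along the affine reference -/

/-- Centred labels of a chunk for the second-order affine slope leaf (curvature-kit guards on the hull box). -/
def htScA2F (c w : (Fin 3 × Fin 3) ⊕ Fin 3 → ℤ) (J : Fin 3 → Fin 3 × Fin 3 → ℤ) (L : List (Fin 3 → ℤ)) : List (Fin 3 → ℤ) :=
  L.filter fun b => ljLabelOK c (hullW J w) b
/-- Naive labels of a chunk for the second-order affine slope leaf. -/
def htSnA2F (c w : (Fin 3 × Fin 3) ⊕ Fin 3 → ℤ) (J : Fin 3 → Fin 3 × Fin 3 → ℤ) (L : List (Fin 3 → ℤ)) : List (Fin 3 → ℤ) :=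
  L.filter fun b => !ljLabelOK c (hullW J w) b
/-- The naive guard of a chunk (second-order affine leaf). -/
def htNaiOKA2F (c w : (Fin 3 × Fin 3) ⊕ Fin 3 → ℤ) (J : Fin 3 → Fin 3 × Fin 3 → ℤ) (L : List (Fin 3 → ℤ)) : Bool :=
  (htSnA2F c w J L).all fun b => (naiveLJ c (hullW J w) b).isSome
/-- ★ The computed slope constant of a chunk along the affine reference, SECOND-ORDER CENTRED form. -/
def htGsA2F (c w : (Fin 3 × Fin 3) ⊕ Fin 3 → ℤ) (J : Fin 3 → Fin 3 × Fin 3 → ℤ) (L : List (Fin 3 → ℤ)) : ℤ :=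
  slopeGsLJA2F c w J (htScA2F c w J L) (htSnA2F c w J L)

/-- ★ **Per-chunk reference force bound along the affine reference, second-order centred form.** [folklore chaining: `forceLJA2F_ref_bound_of_check`] -/
theorem refForce_chunkA2F_le {c w : (Fin 3 × Fin 3) ⊕ Fin 3 → ℤ} {J : Fin 3 → Fin 3 × Fin 3 → ℤ} {L : List (Fin 3 → ℤ)} (hL : L.Nodup)
    (hn : htNaiOKA2F c w J L = true) (U : E3 →L[ℝ] E3) (hU : ‖U - 1‖ ≤ 1 / 4)
    (hbox : ∀ ab : Fin 3 × Fin 3, |(U (EuclideanSpace.single ab.2 (1 : ℝ))) ab.1 - (c (Sum.inl ab) : ℝ) / SC| ≤ (w (Sum.inl ab) : ℝ) / SC)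
    (hn₀ : ‖affShuf J c U‖ ≤ 1 / 4) (ξ : E3) :
    |∑ bb ∈ L.toFinset, (‖latPt U hexFrame bb + U (hcpShift + affShuf J c U)‖⁻¹ ^ 8 - ‖latPt U hexFrame bb + U (hcpShift + affShuf J c U)‖⁻¹ ^ 14) *
        ⟪latPt U hexFrame bb + U (hcpShift + affShuf J c U), U (ξ - affShuf J c U)⟫| ≤ (htGsA2F c w J L : ℝ) / SC * ‖U (ξ - affShuf J c U)‖ := by
  classical
  have hcheck := slopeCheckLJA2F_slopeGsLJA2F (all_filter_self L fun b => ljLabelOK c (hullW J w) b) hn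
  have key := forceLJA2F_ref_bound_of_check (nodup_filter_append hL fun b => ljLabelOK c (hullW J w) b) hcheck U hU hbox hn₀ ξ
  rw [toFinset_filter_append] at key
  exact key

/-- ★ **The reference force bound over `B = htBU` along the affine reference** from the three chunk bounds. [folklore: additivity, verbatim
`…HomEntryLeafHTUKit.refForce_htBU_le`] -/
theorem refForce_htBU_leA2F {c w : (Fin 3 × Fin 3) ⊕ Fin 3 → ℤ} {J : Fin 3 → Fin 3 × Fin 3 → ℤ} (h1 : htNaiOKA2F c w J (htNearU c w) = true)
    (h2 : htNaiOKNA c w J (htFar1U c w) = true) (h3 : htNaiOKNA c w J (htFar2U c w) = true) (U : E3 →L[ℝ] E3) (hU : ‖U - 1‖ ≤ 1 / 4)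
    (hbox : ∀ ab : Fin 3 × Fin 3, |(U (EuclideanSpace.single ab.2 (1 : ℝ))) ab.1 - (c (Sum.inl ab) : ℝ) / SC| ≤ (w (Sum.inl ab) : ℝ) / SC)
    (hn₀ : ‖affShuf J c U‖ ≤ 1 / 4) (ξ : E3) :
    |∑ bb ∈ (htBU c w).toFinset, (‖latPt U hexFrame bb + U (hcpShift + affShuf J c U)‖⁻¹ ^ 8 - ‖latPt U hexFrame bb + U (hcpShift + affShuf J c U)‖⁻¹ ^ 14) *
        ⟪latPt U hexFrame bb + U (hcpShift + affShuf J c U), U (ξ - affShuf J c U)⟫| ≤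
      ((htGsA2F c w J (htNearU c w) + htGsNA c w J (htFar1U c w) + htGsNA c w J (htFar2U c w) : ℤ) : ℝ) / SC * ‖U (ξ - affShuf J c U)‖ := by
  classical
  have hN : (htNearU c w).Nodup := (htUniv_nodup c w).filter _
  have hF1 : (htFar1U c w).Nodup := (htUniv_nodup c w).filter _
  have hF2 : (htFar2U c w).Nodup := (htUniv_nodup c w).filter _
  have k1 := refForce_chunkA2F_le hN h1 U hU hbox hn₀ ξ
  have k2 := refForce_chunkNA_le hF1 h2 U hU hbox hn₀ ξ
  have k3 := refForce_chunkNA_le hF2 h3 U hU hbox hn₀ ξ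
  obtain ⟨h12, _, hd3⟩ := List.nodup_append.1 (htBU_nodup c w)
  obtain ⟨_, _, hd2⟩ := List.nodup_append.1 h12
  have hd3' : List.Disjoint ((htCenU c w ++ htNaiU c w) ++ htFar1U c w) (htFar2U c w) := fun a ha hb => hd3 a ha a hb rfl
  have hd2' : List.Disjoint (htCenU c w ++ htNaiU c w) (htFar1U c w) := fun a ha hb => hd2 a ha a hb rfl
  have hnear : (htCenU c w ++ htNaiU c w).toFinset = (htNearU c w).toFinset := toFinset_filter_append (htNearU c w) fun b => isCenLJ c w b
  rw [htBU, List.toFinset_append, Finset.sum_union (List.disjoint_toFinset_iff_disjoint.2 hd3'), List.toFinset_append,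
    Finset.sum_union (List.disjoint_toFinset_iff_disjoint.2 hd2'), hnear]
  push_cast
  rw [add_div, add_div, add_mul, add_mul]
  refine (abs_add_le _ _).trans (add_le_add ((abs_add_le _ _).trans (add_le_add k1 k2)) k3)

/-! ## §2. The sheet-tracked inner box, the certificate side, the leaf, ★★★ soundness -/

/-- ★ **THE FUSED CERTIFICATE SIDE ALONG THE AFFINE REFERENCE, SECOND-ORDER NEAR CHUNK.** -/
def htCertSideA2F (p : HTCert) (J : Fin 3 → Fin 3 × Fin 3 → ℤ) (c w : (Fin 3 × Fin 3) ⊕ Fin 3 → ℤ) : Bool :=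
  xiBallOK c w && jacOK J w && htROKU c w && htCertOKU p c w &&
    curvCheckLJM c w (htCenU c w) (htNaiU c w) p.D p.lam₁ && forceJacCheckN c w (htFar1U c w) p.lam₂ && forceJacCheckN c w (htFar2U c w) p.lam₃ &&
    (htNaiOKA2F c w J (htNearU c w) && htNaiOKNA c w J (htFar1U c w) && htNaiOKNA c w J (htFar2U c w)) &&
    decide (htGsA2F c w J (htNearU c w) + htGsNA c w J (htFar1U c w) + htGsNA c w J (htFar2U c w) ≤ p.Gs)

/-- ★ **THE ANALYTIC-SLAB LEAF WITH THE AFFINE REFERENCE (second-order near chunk) AND AN INNER SUB-TREE OVER THE SHEET-TRACKED CONFINED BOX.** -/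
def entryLeafOKHT4A2F (inner : ((Fin 3 × Fin 3) ⊕ Fin 3 → ℤ) → ((Fin 3 × Fin 3) ⊕ Fin 3 → ℤ) → Bool) (p : HTCert) (J : Fin 3 → Fin 3 × Fin 3 → ℤ)
    (t : CertTree ((Fin 3 × Fin 3) ⊕ Fin 3)) (c w : (Fin 3 × Fin 3) ⊕ Fin 3 → ℤ) : Bool :=
  htCertSideA2F p J c w && treeOK (hullInner inner J c) t c (htWr p c w)

/-- ★★★ **SOUNDNESS OF `entryLeafOKHT4A2F` IN THE hver SHAPE, FOR ANY SOUND INNER VERDICT.** [folklore chaining: `entryLeafOKHT4U_sound` with the reference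
shuffle `ξ₀ := affShuf J c U`; the inner step through `…HomCertTree.treeOK_sound` on the `(U, ζ)` coordinates and `hull_point`] -/
theorem entryLeafOKHT4A2F_sound {μ : ℤ} {inner : ((Fin 3 × Fin 3) ⊕ Fin 3 → ℤ) → ((Fin 3 × Fin 3) ⊕ Fin 3 → ℤ) → Bool}
    (hinner : ∀ c w, inner c w = true → ∀ (U : E3 →L[ℝ] E3) (ξ : E3), (∀ v v' : E3, ⟪U v, v'⟫ = ⟪v, U v'⟫) → ‖U - 1‖ ≤ 1 / 4 →
      (∀ ab : Fin 3 × Fin 3, |(U (EuclideanSpace.single ab.2 (1 : ℝ))) ab.1 - (c (Sum.inl ab) : ℝ) / SC| ≤ (w (Sum.inl ab) : ℝ) / SC) →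
      (∀ i : Fin 3, |ξ i - (c (Sum.inr i) : ℝ) / SC| ≤ (w (Sum.inr i) : ℝ) / SC) → 0 ≤ ξ 0 → 0 ≤ ξ 2 →
      (∀ (M : ℕ) (z : Fin M → E3) (cc : Fin M), Function.Injective z →
          Set.range z = {x : E3 | dist x (z cc) ≤ 133 / 10 ∧ ∃ a : Fin 3 → ℤ,
            x = z cc + latPt U hexFrame a ∨ x = z cc + latPt U hexFrame a + U (hcpShift + ξ)} →
          TightNearCap (9 / 5) (3 / 2) z cc ∨ ExemptNear (9 / 5) ExRec z cc ∨ BadNearCap (9 / 5) (3 / 2) z cc) ∨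
        (μ : ℝ) / SC ≤ ∑ b ∈ (Fintype.piFinset fun _ : Fin 3 => Finset.Icc (-7 : ℤ) 7).filter (fun b => b ≠ 0), effPot w₄₅ ω₄ (3 / 400) ‖latPt U hexFrame b‖ +
          ∑ b ∈ (Fintype.piFinset fun _ : Fin 3 => Finset.Icc (-7 : ℤ) 7), effPot w₄₅ ω₄ (3 / 400) ‖latPt U hexFrame b + U (hcpShift + ξ)‖)
    {p : HTCert} {J : Fin 3 → Fin 3 × Fin 3 → ℤ} {t : CertTree ((Fin 3 × Fin 3) ⊕ Fin 3)} {c w : (Fin 3 × Fin 3) ⊕ Fin 3 → ℤ}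
    (h : entryLeafOKHT4A2F inner p J t c w = true) (U : E3 →L[ℝ] E3) (ξ : E3)
    (hsa : ∀ v v' : E3, ⟪U v, v'⟫ = ⟪v, U v'⟫) (hU : ‖U - 1‖ ≤ 1 / 4)
    (hbox : ∀ ab : Fin 3 × Fin 3, |(U (EuclideanSpace.single ab.2 (1 : ℝ))) ab.1 - (c (Sum.inl ab) : ℝ) / SC| ≤ (w (Sum.inl ab) : ℝ) / SC)
    (hξ : ∀ i : Fin 3, |ξ i - (c (Sum.inr i) : ℝ) / SC| ≤ (w (Sum.inr i) : ℝ) / SC) (h0 : 0 ≤ ξ 0) (h2 : 0 ≤ ξ 2) :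
    (∀ (M : ℕ) (z : Fin M → E3) (cc : Fin M), Function.Injective z →
        Set.range z = {x : E3 | dist x (z cc) ≤ 133 / 10 ∧ ∃ a : Fin 3 → ℤ,
          x = z cc + latPt U hexFrame a ∨ x = z cc + latPt U hexFrame a + U (hcpShift + ξ)} →
        TightNearCap (9 / 5) (3 / 2) z cc ∨ ExemptNear (9 / 5) ExRec z cc ∨ BadNearCap (9 / 5) (3 / 2) z cc) ∨
      (μ : ℝ) / SC ≤ ∑ b ∈ (Fintype.piFinset fun _ : Fin 3 => Finset.Icc (-7 : ℤ) 7).filter (fun b => b ≠ 0), effPot w₄₅ ω₄ (3 / 400) ‖latPt U hexFrame b‖ +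
        ∑ b ∈ (Fintype.piFinset fun _ : Fin 3 => Finset.Icc (-7 : ℤ) 7), effPot w₄₅ ω₄ (3 / 400) ‖latPt U hexFrame b + U (hcpShift + ξ)‖ := by
  classical
  have hS : (0 : ℝ) < SC := by norm_num [SC]
  unfold entryLeafOKHT4A2F htCertSideA2F at h
  simp only [Bool.and_eq_true, decide_eq_true_eq] at h
  obtain ⟨⟨⟨⟨⟨⟨⟨⟨⟨hball, hjac⟩, hROK⟩, hcert⟩, hcurvM⟩, hfar1⟩, hfar2⟩, ⟨⟨hs1, hs2⟩, hs3⟩⟩, hGs⟩, htree⟩ := h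
  obtain ⟨hKlt, hT, hγ, hr, hconf⟩ := htCertOKU_spec hcert
  -- the reference shuffle: the AFFINE (sheet-tracking) reference at `U`
  set ξ₀ : E3 := affShuf J c U with hξ₀def
  have hw0 : ∀ i : Fin 3, (0 : ℝ) ≤ (w (Sum.inr i) : ℝ) / SC := fun i => (abs_nonneg _).trans (hξ i)
  have hξ₀box : ∀ i : Fin 3, |ξ₀ i - (c (Sum.inr i) : ℝ) / SC| ≤ (w (Sum.inr i) : ℝ) / SC := by
    intro i
    refine (abs_affShuf_sub_le (J := J) (w := w) U hbox i).trans ?_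
    rw [div_le_div_iff_of_pos_right hS]
    exact_mod_cast jacOK_spec hjac i
  have hn : ‖ξ‖ ≤ 1 / 4 := norm_le_quarter_of_xiBallOK hball hξ
  have hn₀ : ‖ξ₀‖ ≤ 1 / 4 := norm_le_quarter_of_xiBallOK hball hξ₀box
  -- label finsets
  set B : Finset (Fin 3 → ℤ) := (htBU c w).toFinset with hBdef
  set R : Finset (Fin 3 → ℤ) := (htRU c w).toFinset with hRdef
  have hB : B ⊆ Fintype.piFinset fun _ : Fin 3 => Finset.Icc (-11 : ℤ) 11 := by
    intro b hb
    rw [← boxLabels11_toFinset]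
    exact List.mem_toFinset.2 (mem_boxLabels11_of_mem_htUniv (mem_htUniv_of_mem_htBU (List.mem_toFinset.1 hb)))
  have hBin : ∀ bb ∈ B, ‖latPt U hexFrame bb + U (hcpShift + ξ)‖ ≤ 7 :=
    fun bb hbb => norm_le_seven_of_htIn U hbox ξ hξ (htIn_of_mem_htBU (List.mem_toFinset.1 hbb))
  have hR : ∀ bb ∈ (Fintype.piFinset fun _ : Fin 3 => Finset.Icc (-11 : ℤ) 11) \ B, ‖latPt U hexFrame bb + U (hcpShift + ξ)‖ ≤ 7 →
      bb ∈ R ∧ 6 ≤ ‖latPt U hexFrame bb + U (hcpShift + ξ)‖ := by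
    intro bb hbb h7
    obtain ⟨hbox11, hnotB⟩ := Finset.mem_sdiff.1 hbb
    rw [← boxLabels11_toFinset] at hbox11
    have hbL : bb ∈ boxLabels11 := List.mem_toFinset.1 hbox11
    have hlo := lo_le_of_norm_le_seven U hbox ξ hξ h7
    by_cases huniv : bb ∈ htUniv c w
    swap
    · exact absurd h7 (not_le.2 (seven_lt_norm_of_not_mem_htUniv U hbox hξ hKlt hbL huniv))
    by_cases hin : htIn c w bb = true
    · exact absurd (List.mem_toFinset.2 (mem_htBU_of_htIn huniv hin)) hnotB
    · have hmemR : bb ∈ htRU c w := by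
        refine List.mem_filter.2 ⟨huniv, ?_⟩
        simp only [Bool.and_eq_true, Bool.not_eq_true', decide_eq_true_eq]
        exact ⟨by simpa using hin, hlo⟩
      have h36 : 36 * (SC : ℤ) ≤ (fjQ c w bb).lo := by
        have := List.all_eq_true.1 hROK bb hmemR
        simpa using this
      exact ⟨List.mem_toFinset.2 hmemR, six_le_norm_of_lo U hbox ξ hξ h36⟩
  -- the Q-floor along the segment
  have hcurv : ∀ s ∈ Set.Ioo (0 : ℝ) 1,
      ((p.lam₁ + p.lam₂ + p.lam₃ : ℤ) : ℝ) / SC * ‖U (ξ - ξ₀)‖ ^ 2 + ∑ i : Fin 3, ∑ j : Fin 3, (p.D i j : ℝ) / SC * ((U (ξ - ξ₀)) i * (U (ξ - ξ₀)) j) ≤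
        ∑ bb ∈ B, segGd (fun x : ℝ => x⁻¹ ^ 7 - x⁻¹ ^ 13) (latPt U hexFrame bb + U (hcpShift + ξ₀)) (U (ξ - ξ₀)) s :=
    fun s hs => jac_floorM_of_three_checks (htBU_nodup c w) hcurvM hfar1 hfar2 U hU hbox ξ₀ ξ hξ₀box hξ hn₀ hn hs
  -- the reference force bound ALONG THE AFFINE REFERENCE, chunked
  have hf₀ : |∑ bb ∈ B, (‖latPt U hexFrame bb + U (hcpShift + ξ₀)‖⁻¹ ^ 8 - ‖latPt U hexFrame bb + U (hcpShift + ξ₀)‖⁻¹ ^ 14) *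
      ⟪latPt U hexFrame bb + U (hcpShift + ξ₀), U (ξ - ξ₀)⟫| ≤ (p.Gs : ℝ) / SC * ‖U (ξ - ξ₀)‖ := by
    have key := refForce_htBU_leA2F hs1 hs2 hs3 U hU hbox hn₀ ξ
    refine key.trans (mul_le_mul_of_nonneg_right ?_ (norm_nonneg _))
    rw [div_le_div_iff_of_pos_right hS]
    exact_mod_cast hGs
  -- slab ⟹ confinement ⟹ the inner verdict on the sheet-tracked confined box
  have hslab : ((p.lam₁ + p.lam₂ + p.lam₃ : ℤ) : ℝ) / SC * ‖U (ξ - ξ₀)‖ ^ 2 +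
        ∑ i : Fin 3, ∑ j : Fin 3, (p.D i j : ℝ) / SC * ((U (ξ - ξ₀)) i * (U (ξ - ξ₀)) j) ≤
      ((6000 / 343 * (7 : ℝ)⁻¹ ^ 4 + 2880 / 49 * (7 : ℝ)⁻¹ ^ 5 + 10 / 7 * (7 : ℝ)⁻¹ ^ 6 + 2 * (7 : ℝ)⁻¹ ^ 7) + (p.Gs : ℝ) / SC +
        R.card * (6 : ℝ)⁻¹ ^ 7) * ‖U (ξ - ξ₀)‖ →
      (∀ (M : ℕ) (z : Fin M → E3) (cc : Fin M), Function.Injective z →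
          Set.range z = {x : E3 | dist x (z cc) ≤ 133 / 10 ∧ ∃ a : Fin 3 → ℤ,
            x = z cc + latPt U hexFrame a ∨ x = z cc + latPt U hexFrame a + U (hcpShift + ξ)} →
          TightNearCap (9 / 5) (3 / 2) z cc ∨ ExemptNear (9 / 5) ExRec z cc ∨ BadNearCap (9 / 5) (3 / 2) z cc) ∨
        (μ : ℝ) / SC ≤ ∑ b ∈ (Fintype.piFinset fun _ : Fin 3 => Finset.Icc (-7 : ℤ) 7).filter (fun b => b ≠ 0), effPot w₄₅ ω₄ (3 / 400) ‖latPt U hexFrame b‖ +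
          ∑ b ∈ (Fintype.piFinset fun _ : Fin 3 => Finset.Icc (-7 : ℤ) 7), effPot w₄₅ ω₄ (3 / 400) ‖latPt U hexFrame b + U (hcpShift + ξ)‖ := by
    intro hq
    have ht0 : (0 : ℝ) < (htTU p c w : ℝ) / SC := div_pos (by exact_mod_cast hT) hS
    have hle := slabConst_le_htTU p c w
    have hQ : (p.lamT : ℝ) / SC * ‖U (ξ - ξ₀)‖ ^ 2 + ∑ i : Fin 3, ∑ j : Fin 3, (p.D i j : ℝ) / SC * ((U (ξ - ξ₀)) i * (U (ξ - ξ₀)) j) ≤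
        (htTU p c w : ℝ) / SC * ‖U (ξ - ξ₀)‖ := by
      have e : (p.lamT : ℝ) = ((p.lam₁ + p.lam₂ + p.lam₃ : ℤ) : ℝ) := by simp [HTCert.lamT]
      rw [e]
      exact hq.trans (mul_le_mul_of_nonneg_right hle (norm_nonneg _))
    have hΔk : ∀ k : Fin 3, |(U (ξ - ξ₀)) k| ≤ (p.rS k : ℝ) / SC := fun k =>
      abs_apply_le_of_qcert (Q := fun x : E3 => (p.lamT : ℝ) / SC * ‖x‖ ^ 2 + ∑ i : Fin 3, ∑ j : Fin 3, (p.D i j : ℝ) / SC * (x i * x j))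
        ht0 (div_pos (by exact_mod_cast hγ k) hS) (div_nonneg (by exact_mod_cast hr k) hS.le) k (fun x => htConfU_sound (hconf k) x) hQ
    have hy := fun k => abs_coord_le_of_confined hU (ξ - ξ₀) (r := fun j => (p.rS j : ℝ) / SC) (κ := fun k => (htκ c w k : ℝ) / SC) hΔk
      (rowDev_le U hbox) k
    -- the sheet-tracked confined box: `ζ = ξ − ξ₀(U)` recentred at `ξ_c`
    have hζ : ∀ i : Fin 3, |((c (Sum.inr i) : ℝ) / SC + (ξ - ξ₀) i) - (c (Sum.inr i) : ℝ) / SC| ≤ (htW p c w (Sum.inr i) : ℝ) / SC := by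
      intro i
      rw [add_sub_cancel_left]
      refine (hy i).trans ?_
      rw [htW_inr]
      have hρ := sqrt_le_htρ p
      have hκ0 : (0 : ℝ) ≤ (htκ c w i : ℝ) / SC :=
        (Finset.sum_nonneg fun j _ => abs_nonneg _).trans (rowDev_le U hbox i)
      have hcd := div_le_cdiv (a := htκ c w i * 4 * htρ p) (b := 3 * (SC : ℤ)) (by norm_num [SC])
      have step : (htκ c w i : ℝ) / SC * (4 / 3 * Real.sqrt (∑ j : Fin 3, ((p.rS j : ℝ) / SC) ^ 2)) ≤
          ((cdiv (htκ c w i * 4 * htρ p) (3 * SC) : ℤ) : ℝ) / SC := by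
        have h1 : (htκ c w i : ℝ) / SC * (4 / 3 * Real.sqrt (∑ j : Fin 3, ((p.rS j : ℝ) / SC) ^ 2)) ≤
            (htκ c w i : ℝ) / SC * (4 / 3 * ((htρ p : ℝ) / SC)) := by gcongr
        refine h1.trans ?_
        rw [le_div_iff₀ hS]
        have e : (htκ c w i : ℝ) / SC * (4 / 3 * ((htρ p : ℝ) / SC)) * SC = ((htκ c w i * 4 * htρ p : ℤ) : ℝ) / ((3 * (SC : ℤ) : ℤ) : ℝ) := by
          push_cast; field_simp
        rw [e]; exact hcd
      push_cast
      rw [add_div]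
      linarith
    -- the tree point `(U_ab, ξ_c,i + ζ_i)` lies in the rounded confined box; run the inner certificate tree there
    have hx : ∀ k, |(Sum.elim (fun ab : Fin 3 × Fin 3 => (U (EuclideanSpace.single ab.2 (1 : ℝ))) ab.1)
        (fun i : Fin 3 => (c (Sum.inr i) : ℝ) / SC + (ξ - ξ₀) i) k) - (c k : ℝ) / SC| ≤ (htWr p c w k : ℝ) / SC := by
      intro k
      rcases k with ab | i
      · exact hbox ab
      · refine (hζ i).trans ?_
        rw [div_le_div_iff_of_pos_right hS]
        exact_mod_cast htW_le_htWr p c w i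
    have key := treeOK_sound SC_pos
      (P := fun x : (Fin 3 × Fin 3) ⊕ Fin 3 → ℝ => ∀ (V : E3 →L[ℝ] E3) (η : E3), (∀ v v' : E3, ⟪V v, v'⟫ = ⟪v, V v'⟫) → ‖V - 1‖ ≤ 1 / 4 →
        (∀ ab : Fin 3 × Fin 3, (V (EuclideanSpace.single ab.2 (1 : ℝ))) ab.1 = x (Sum.inl ab)) →
        (∀ i : Fin 3, η i = x (Sum.inr i) + (affShuf J c V - cenShuf c) i) → 0 ≤ η 0 → 0 ≤ η 2 →
        (∀ (M : ℕ) (z : Fin M → E3) (cc : Fin M), Function.Injective z →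
            Set.range z = {x : E3 | dist x (z cc) ≤ 133 / 10 ∧ ∃ a : Fin 3 → ℤ,
              x = z cc + latPt V hexFrame a ∨ x = z cc + latPt V hexFrame a + V (hcpShift + η)} →
            TightNearCap (9 / 5) (3 / 2) z cc ∨ ExemptNear (9 / 5) ExRec z cc ∨ BadNearCap (9 / 5) (3 / 2) z cc) ∨
          (μ : ℝ) / SC ≤ ∑ b ∈ (Fintype.piFinset fun _ : Fin 3 => Finset.Icc (-7 : ℤ) 7).filter (fun b => b ≠ 0), effPot w₄₅ ω₄ (3 / 400) ‖latPt V hexFrame b‖ +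
            ∑ b ∈ (Fintype.piFinset fun _ : Fin 3 => Finset.Icc (-7 : ℤ) 7), effPot w₄₅ ω₄ (3 / 400) ‖latPt V hexFrame b + V (hcpShift + η)‖)
      (hullInner inner J c) (fun c' w' hv x hx' V η hVsa hV1 hVx hηx h0' h2' => by
        have hVb : ∀ ab : Fin 3 × Fin 3, |(V (EuclideanSpace.single ab.2 (1 : ℝ))) ab.1 - (c' (Sum.inl ab) : ℝ) / SC| ≤ (w' (Sum.inl ab) : ℝ) / SC :=
          fun ab => by rw [hVx ab]; exact hx' (Sum.inl ab)
        refine hinner (hullC J c c') (hullWd J w') hv V η hVsa hV1 (fun ab => hVb ab) (fun i => ?_) h0' h2'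
        rw [hηx i]
        exact hull_point V hVb (hx' (Sum.inr i)))
      t c (htWr p c w) htree _ hx U ξ hsa hU (fun _ => rfl) (fun i => by
        show ξ i = (c (Sum.inr i) : ℝ) / SC + (ξ - ξ₀) i + (affShuf J c U - cenShuf c) i
        rw [PiLp.sub_apply, PiLp.sub_apply, cenShuf_apply, hξ₀def]; ring) h0 h2
    exact key
  exact hver_of_slabParts hU hn₀ hn B R hB hBin hR hcurv hf₀ hslab

end Summit.AtomisticToContinuum.Crystallization.Theorems.FrustratedLawDichotomyStrainedPatchHomEntryLeafHT

end
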